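import Mathlib.Data.Set.Finite.List
import Literature.Probability.RandomPlanarGeometry.USTPeanoPeelingStep
import HarnessLib

/-!
# The forward Markov property of Peano paths ([LSW04] Lemma 4.1): the first step is available

G. F. Lawler, O. Schramm, W. Werner, Ann. Probab. **32** (2004), §4.1, Lemma 4.1 (p. 972):
"Conditioned on `γ[0,n]`, the distribution of `(γ ∖ γ[0,n]) ∪ {wₙ}` is the same as that of the
UST Peano curve associated with `(αₙ(γ), βₙ(γ), wₙ, b)`."  The tree's peeling framework
(`USTPeanoPeeling.lean`, `USTPeanoPeelingStep.lean`) proves the BACKWARD half at `n = 1`: a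
Peano path of the peeled data `S.peelE` extends to a Peano path of `S` (`IsPath.cons_peelE`),
under the availability condition `CanE S` of the dual step.  This file proves the FORWARD half:

* `PeelData.IsPath.canE_of_head` — **if a Peano path of good peeling data starts with the dual
  step `a → stepD a`, that step is available** (`CanE S`): the crossed dual edge is not a wall
  (the step is unblocked) and the primal edge `f₁ = [α_a, farP a]` alongside it can be added to
  `α` — if `farP a` were a vertex of `α` other than its second one, the closed primal walk
  `α_a, …, farP a, α_a` would be crossed exactly once (in the pair `(f₁, f₂)`) by the closed dual
  walk formed by the dual neighbours of the path up to its visit of `stepP a` (which it must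
  visit, the primal step from `a` being then unblocked) and the edge `f₂`, contradicting the
  parity lemma `crossings_mod_two` — the same mechanism as `Good.false_of_mem_of_mem`;
* `PeelData.IsPath.tail_peelE` — the rest of such a path is a Peano path of the peeled data;
* `dualWalk` — the walk of dual neighbours of a Manhattan path (consecutive repeats merged), an
  auxiliary for the parity argument (`isChain_dualWalk`, `exists_step_of_mem_zip_dualWalk`);
* `PeelData.swap_swap`, `PeelData.IsPath.swap` — the primal/dual exchange is an involution;
* `PeelData.pathSplit` — **the classification of Peano paths by their first step**, an
  equivalence `{l // S.IsPath l} ≃ {l // CanE S ∧ S.peelE.IsPath l} ⊕ {l // CanE S.swap ∧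
  S.swap.peelE.IsPath l}` (interior vertex present), and the resulting **counting recursion**
  `PeelData.card_isPath_eq`; `PeelData.IsPath.eq_pair_of_empty`, `card_isPath_of_empty` (no
  interior vertex: the unique path `[a, b]`); finiteness `PeelData.instFinite_isPath`.

These are the path-side ingredients of the bijection between Peano paths and spanning trees
containing `α` ([LSW04] p. 972, "`T ↦ γ(T)` is a bijection between the set of spanning trees of
`H` containing `α` and the set of oriented paths in `G⃗ ∩ D̄` from `a` to `b` containing `V_P`").
-/

namespace Literature.Probability.RandomPlanarGeometry

namespace USTPeano

/-! ### Successors and predecessors in a simple path -/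

/-- In a repetition-free list the successor of a vertex is unique. [folklore] -/
theorem eq_of_mem_zip_tail_fst :
    ∀ {l : List (ℤ × ℤ)}, l.Nodup → ∀ {x y y' : ℤ × ℤ},
      (x, y) ∈ l.zip l.tail → (x, y') ∈ l.zip l.tail → y = y'
  | [], _, _, _, _, h, _ => by simp at h
  | [u], _, _, _, _, h, _ => by simp at h
  | u :: v :: t, hnd, x, y, y', h, h' => by
    rw [zip_tail_cons_cons, List.mem_cons] at h h'
    have hu : u ∉ v :: t := (List.nodup_cons.1 hnd).1
    rcases h with h | h <;> rcases h' with h' | h'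
    · simp only [Prod.mk.injEq] at h h'
      rw [h.2, h'.2]
    · simp only [Prod.mk.injEq] at h
      exact absurd (h.1 ▸ (List.of_mem_zip h').1) hu
    · simp only [Prod.mk.injEq] at h'
      exact absurd (h'.1 ▸ (List.of_mem_zip h).1) hu
    · exact eq_of_mem_zip_tail_fst (List.nodup_cons.1 hnd).2 h h'

/-- In a repetition-free list the predecessor of a vertex is unique. [folklore] -/
theorem eq_of_mem_zip_tail_snd :
    ∀ {l : List (ℤ × ℤ)}, l.Nodup → ∀ {x x' y : ℤ × ℤ},
      (x, y) ∈ l.zip l.tail → (x', y) ∈ l.zip l.tail → x = x'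
  | [], _, _, _, _, h, _ => by simp at h
  | [u], _, _, _, _, h, _ => by simp at h
  | u :: v :: t, hnd, x, x', y, h, h' => by
    rw [zip_tail_cons_cons, List.mem_cons] at h h'
    have hv : v ∉ t := (List.nodup_cons.1 (List.nodup_cons.1 hnd).2).1
    rcases h with h | h <;> rcases h' with h' | h'
    · simp only [Prod.mk.injEq] at h h'
      rw [h.1, h'.1]
    · simp only [Prod.mk.injEq] at h
      exact absurd (h.2 ▸ (List.of_mem_zip h').2) hv
    · simp only [Prod.mk.injEq] at h'
      exact absurd (h'.2 ▸ (List.of_mem_zip h).2) hv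
    · exact eq_of_mem_zip_tail_snd (List.nodup_cons.1 hnd).2 h h'

/-- Two vertices crossing the same dual edge are equal or co-sources of each other (the dual
form of `eq_or_eq_coSrc_of_farP`, by the primal/dual exchange). [folklore] -/
theorem eq_or_eq_coSrc_of_farD {p q : ℤ × ℤ}
    (h : s(dualNbr p, farD p) = s(dualNbr q, farD q)) : p = q ∨ p = coSrc q := by
  have h' : s(primalNbr (swapIdx p), farP (swapIdx p)) =
      s(primalNbr (swapIdx q), farP (swapIdx q)) := by
    simp only [primalNbr_swapIdx, farP_swapIdx]
    have := congrArg (Sym2.map swapIdx) h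
    simpa using this
  rcases eq_or_eq_coSrc_of_farP h' with h1 | h1
  · exact Or.inl (swapIdx_injective h1)
  · right
    rw [coSrc_swapIdx] at h1
    exact swapIdx_injective h1

/-! ### The walk of dual neighbours of a Manhattan path -/

/-- **The dual walk of a Manhattan path**: the sequence of the dual neighbours of its vertices,
with consecutive repetitions merged (the dual neighbour changes exactly along the primal steps,
where it moves along the dual edge crossing the primal edge that the step crosses).
[folklore] -/
def dualWalk : List (ℤ × ℤ) → List (ℤ × ℤ)
  | [] => []
  | [p] => [dualNbr p]
  | p :: q :: t => if dualNbr q = dualNbr p then dualWalk (q :: t) else dualNbr p :: dualWalk (q :: t)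

/-- `dualWalk` on a list with at least two vertices. [folklore] -/
theorem dualWalk_cons_cons (p q : ℤ × ℤ) (t : List (ℤ × ℤ)) :
    dualWalk (p :: q :: t) =
      if dualNbr q = dualNbr p then dualWalk (q :: t) else dualNbr p :: dualWalk (q :: t) := rfl

/-- The dual walk of a nonempty path is nonempty. [folklore] -/
theorem dualWalk_ne_nil : ∀ {l : List (ℤ × ℤ)}, l ≠ [] → dualWalk l ≠ []
  | [], h => absurd rfl h
  | [p], _ => by simp [dualWalk]
  | p :: q :: t, _ => by
    rw [dualWalk_cons_cons]
    split_ifs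
    · exact dualWalk_ne_nil (List.cons_ne_nil q t)
    · exact List.cons_ne_nil _ _

/-- The dual walk starts at the dual neighbour of the first vertex (`head?` form). [folklore] -/
theorem head?_dualWalk : ∀ (p : ℤ × ℤ) (t : List (ℤ × ℤ)),
    (dualWalk (p :: t)).head? = some (dualNbr p)
  | _, [] => rfl
  | p, q :: t => by
    rw [dualWalk_cons_cons]
    split_ifs with hq
    · rw [head?_dualWalk q t, hq]
    · rfl

/-- The dual walk starts at the dual neighbour of the first vertex. [folklore] -/
theorem head_dualWalk (p : ℤ × ℤ) (t : List (ℤ × ℤ)) (h : dualWalk (p :: t) ≠ []) :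
    (dualWalk (p :: t)).head h = dualNbr p :=
  Option.some.inj ((List.head?_eq_some_head h).symm.trans (head?_dualWalk p t))

/-- The dual walk ends at the dual neighbour of the last vertex. [folklore] -/
theorem getLast_dualWalk : ∀ (l : List (ℤ × ℤ)) (h : l ≠ []) (h' : dualWalk l ≠ []),
    (dualWalk l).getLast h' = dualNbr (l.getLast h)
  | [], h, _ => absurd rfl h
  | [p], _, _ => rfl
  | p :: q :: t, _, h' => by
    have hq : (p :: q :: t).getLast (List.cons_ne_nil _ _) = (q :: t).getLast (List.cons_ne_nil _ _) :=
      List.getLast_cons (List.cons_ne_nil q t)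
    rw [hq, ← getLast_dualWalk (q :: t) (List.cons_ne_nil q t) (dualWalk_ne_nil (List.cons_ne_nil q t))]
    by_cases he : dualNbr q = dualNbr p
    · have e : dualWalk (p :: q :: t) = dualWalk (q :: t) := by rw [dualWalk_cons_cons, if_pos he]
      simp only [e]
    · have e : dualWalk (p :: q :: t) = dualNbr p :: dualWalk (q :: t) := by
        rw [dualWalk_cons_cons, if_neg he]
      simp only [e]
      exact List.getLast_cons (dualWalk_ne_nil (List.cons_ne_nil q t))

/-- The dual walk of a Manhattan path is a walk of the dual lattice. [folklore] -/
theorem isChain_dualWalk : ∀ {l : List (ℤ × ℤ)}, l.IsChain Manhattan → (dualWalk l).IsChain LatticeAdj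
  | [], _ => by simp [dualWalk]
  | [p], _ => by simp [dualWalk]
  | p :: q :: t, h => by
    rw [List.isChain_cons_cons] at h
    rw [dualWalk_cons_cons]
    split_ifs with he
    · exact isChain_dualWalk h.2
    · have hq : q = stepP p := by
        rcases (manhattan_iff_step p q).1 h.1 with rfl | rfl
        · exact absurd (dualNbr_stepD p) he
        · rfl
      refine List.IsChain.cons_of_ne_nil (dualWalk_ne_nil (List.cons_ne_nil q t))
        (isChain_dualWalk h.2) ?_
      rw [head_dualWalk, hq]
      exact latticeAdj_dualNbr_farD p

/-- **The edges of the dual walk are the dual edges crossed-along by the primal steps**: every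
consecutive pair of the dual walk is `(dualNbr p, farD p)` for a primal step `p → stepP p` of the
path. [folklore] -/
theorem exists_step_of_mem_zip_dualWalk :
    ∀ {l : List (ℤ × ℤ)}, l.IsChain Manhattan →
      ∀ f ∈ (dualWalk l).zip (dualWalk l).tail, ∃ p, (p, stepP p) ∈ l.zip l.tail ∧ f = (dualNbr p, farD p)
  | [], _, f, hf => by simp [dualWalk] at hf
  | [p], _, f, hf => by simp [dualWalk] at hf
  | p :: q :: t, h, f, hf => by
    rw [List.isChain_cons_cons] at h
    rw [dualWalk_cons_cons] at hf
    split_ifs at hf with he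
    · obtain ⟨p', hp', rfl⟩ := exists_step_of_mem_zip_dualWalk h.2 f hf
      refine ⟨p', ?_, rfl⟩
      rw [zip_tail_cons_cons]
      exact List.mem_cons_of_mem _ hp'
    · have hq : q = stepP p := by
        rcases (manhattan_iff_step p q).1 h.1 with rfl | rfl
        · exact absurd (dualNbr_stepD p) he
        · rfl
      rw [mem_zip_cons_iff _ _ (dualWalk_ne_nil (List.cons_ne_nil q t))] at hf
      rcases hf with rfl | hf
      · refine ⟨p, ?_, ?_⟩
        · rw [zip_tail_cons_cons, hq]
          exact List.mem_cons_self
        · rw [head_dualWalk, hq]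
          rfl
      · obtain ⟨p', hp', rfl⟩ := exists_step_of_mem_zip_dualWalk h.2 f hf
        refine ⟨p', ?_, rfl⟩
        rw [zip_tail_cons_cons]
        exact List.mem_cons_of_mem _ hp'

namespace PeelData

variable {S : PeelData}

/-! ### The forward Markov property -/

/-- **The first step of a Peano path is an available step** ([LSW04] Lemma 4.1, forward
direction, dual case): if a Peano path of good peeling data starts with the dual step
`a → stepD a`, then `CanE S` — the crossed dual edge `f₂` is not a wall, and `farP a` is not a
vertex of `α` unless `[α_a, farP a]` is the first edge of `α`.  Proof of the second clause by
the parity lemma: otherwise the primal step from `a` is unblocked, so the path visits `stepP a`;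
the dual neighbours of the path up to there form a dual walk from `β_a = dualNbr a` to
`farD a` whose edges cross only primal edges crossed by the path (none of them in `α`, none of
them `f₁`), and closing it with `f₂` gives a closed dual walk crossing the closed primal walk
`α_a, …, farP a, α_a` exactly once. [cite: LawlerSchrammWerner2004, Lemma 4.1] -/
theorem IsPath.canE_of_head (h : S.Good) {l : List (ℤ × ℤ)} (hl : S.IsPath (S.a :: l))
    (hne : l ≠ []) (hhead : l.head hne = stepD S.a) : S.CanE := by
  have hfirst : (S.a, stepD S.a) ∈ (S.a :: l).zip (S.a :: l).tail :=
    (mem_zip_cons_iff S.a l hne _).2 (Or.inl (by rw [hhead]))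
  -- (i) the dual step is unblocked
  have h2 : s(dualNbr S.a, farD S.a) ∉ edgeSet S.β := by
    have := hl.unblocked _ hfirst
    rwa [blocked_stepD_iff] at this
  refine ⟨h2, ?_⟩
  by_contra hc
  rw [not_or, not_not, not_exists] at hc
  obtain ⟨hPα, hnot⟩ := hc
  -- (ii) `f₁` is not an edge of `α`, so the primal step from `a` is on the path
  have h1 : s(primalNbr S.a, farP S.a) ∉ edgeSet S.α := fun hm ↦ by
    obtain ⟨t, ht⟩ := (mem_edgeSet_head_iff h.α_ne h.nodupα h.headα).1 hm
    exact hnot t ht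
  have hPl : stepP S.a ∈ l := by
    have hP : stepP S.a ∈ S.a :: l := by
      rcases h.stepP_mem h1 with hb | hV
      · exact (hl.mem_iff _).2 (Or.inr (Or.inl hb))
      · exact (hl.mem_iff _).2 (Or.inr (Or.inr hV))
    exact (List.mem_cons.1 hP).resolve_left (stepP_ne_self _)
  obtain ⟨l₁, l₂, hl12⟩ := List.append_of_mem hPl
  -- the prefix `w = a :: l₁ ++ [stepP a]` of the path and its dual walk
  set w := S.a :: (l₁ ++ [stepP S.a]) with hw
  have hγ : S.a :: l = w ++ l₂ := by rw [hw, hl12]; simp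
  have hwne : w ≠ [] := List.cons_ne_nil _ _
  have hwc : w.IsChain Manhattan := by
    have := hl.isChain
    rw [hγ] at this
    exact this.left_of_append
  have hwlast : w.getLast hwne = stepP S.a := by simp [hw]
  have hwsub : ∀ e ∈ w.zip w.tail, e ∈ (S.a :: l).zip (S.a :: l).tail := fun e he ↦
    hγ ▸ (zip_tail_sublist_append w l₂).subset he
  set W := dualWalk w with hW
  have hWne : W ≠ [] := dualWalk_ne_nil hwne
  have hWhead : W.head hWne = dualNbr S.a := head_dualWalk _ _ _
  have hWlast : W.getLast hWne = farD S.a :=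
    (getLast_dualWalk w hwne hWne).trans (by rw [hwlast]; rfl)
  -- the prefix `P` of `α` through `farP a`
  obtain ⟨α₁, α₂, hα⟩ := List.append_of_mem hPα
  set P := α₁ ++ [farP S.a] with hP
  have hαP : S.α = P ++ α₂ := by rw [hα, hP, List.append_assoc, List.singleton_append]
  have hPne : P ≠ [] := by simp [hP]
  have hPlast : P.getLast hPne = farP S.a := by simp [hP]
  have hPhead : P.head hPne = primalNbr S.a := by
    rw [← h.headα]
    simp only [hαP]
    exact (List.head_append_left hPne).symm
  have hPsub : ∀ e ∈ P.zip P.tail, e ∈ S.α.zip S.α.tail := fun e he ↦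
    hαP ▸ (zip_tail_sublist_append P α₂).subset he
  -- the closed walks
  set A := P ++ [primalNbr S.a] with hA
  set B := W ++ [dualNbr S.a] with hB
  have hAne : A ≠ [] := by simp [hA]
  have hBne : B ≠ [] := by simp [hB]
  have hAc : A.IsChain LatticeAdj := by
    refine List.IsChain.append (h.chainα |> fun hc ↦ (hαP ▸ hc).left_of_append)
      (List.isChain_singleton _) ?_
    intro x hx y hy
    rw [List.getLast?_eq_getLast_of_ne_nil hPne, Option.mem_def, Option.some.injEq] at hx
    simp only [List.head?_cons, Option.mem_def, Option.some.injEq] at hy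
    subst hx; subst hy
    rw [hPlast]
    exact (latticeAdj_primalNbr_farP _).symm
  have hBc : B.IsChain LatticeAdj := by
    refine List.IsChain.append (isChain_dualWalk hwc) (List.isChain_singleton _) ?_
    intro x hx y hy
    rw [List.getLast?_eq_getLast_of_ne_nil hWne, Option.mem_def, Option.some.injEq] at hx
    simp only [List.head?_cons, Option.mem_def, Option.some.injEq] at hy
    subst hx; subst hy
    rw [hWlast]
    exact (latticeAdj_dualNbr_farD _).symm
  have hAcl : A.head hAne = A.getLast hAne := by
    simp only [hA, List.getLast_append_singleton]
    rw [List.head_append_left hPne, hPhead]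
  have hBcl : B.head hBne = B.getLast hBne := by
    simp only [hB, List.getLast_append_singleton]
    rw [List.head_append_left hWne, hWhead]
  have hpar := crossings_mod_two hAne hAc hAcl hBne hBc hBcl
  -- no edge of `W` crosses an edge of `α`, or `f₁`
  have hWα : ∀ e ∈ S.α.zip S.α.tail, ∀ f ∈ W.zip W.tail, ¬ IsDualPair e.1 e.2 f.1 f.2 := by
    intro e he f hf hd
    obtain ⟨p, hp, rfl⟩ := exists_step_of_mem_zip_dualWalk hwc f hf
    have heq : s(e.1, e.2) = s(primalNbr p, farP p) := hd.eq_of_dual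
    have hub := hl.unblocked _ (hwsub _ hp)
    rw [blocked_stepP_iff, ← heq] at hub
    exact hub (List.mem_map_of_mem he)
  have hWf₁ : ∀ f ∈ W.zip W.tail, ¬ IsDualPair (farP S.a) (primalNbr S.a) f.1 f.2 := by
    intro f hf hd
    obtain ⟨p, hp, rfl⟩ := exists_step_of_mem_zip_dualWalk hwc f hf
    have heq : s(dualNbr p, farD p) = s(dualNbr S.a, farD S.a) := hd.symm_left.eq_of_primal
    have hnd := hl.nodup
    rcases eq_or_eq_coSrc_of_farD heq with rfl | rfl
    · exact stepD_ne_stepP _ (eq_of_mem_zip_tail_fst hnd hfirst (hwsub _ hp))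
    · have hp' := hwsub _ hp
      rw [stepP_coSrc] at hp'
      exact coSrc_ne_self _ (eq_of_mem_zip_tail_snd hnd hp' hfirst)
  -- compute the crossings: exactly one
  have hone : crossings A B = 1 := by
    unfold crossings
    rw [hA, hB, zip_tail_append_singleton P hPne, zip_tail_append_singleton W hWne, hPlast, hWlast]
    simp only [List.map_append, List.map_cons, List.map_nil, List.sum_append, List.sum_cons,
      List.sum_nil, add_zero]
    have hT1 : ((P.zip P.tail).map fun e ↦
        (((W.zip W.tail).map fun f ↦ if IsDualPair e.1 e.2 f.1 f.2 then (1 : ℤ) else 0).sum +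
          if IsDualPair e.1 e.2 (farD S.a) (dualNbr S.a) then (1 : ℤ) else 0)).sum = 0 := by
      refine sum_map_eq_zero_of_forall _ _ fun e he ↦ ?_
      have hz : ((W.zip W.tail).map fun f ↦ if IsDualPair e.1 e.2 f.1 f.2 then (1 : ℤ) else 0).sum =
          0 :=
        sum_map_eq_zero_of_forall _ _ fun f hf ↦ if_neg (hWα e (hPsub e he) f hf)
      rw [hz, zero_add, if_neg]
      intro hd
      exact h1 (hd.symm_right.eq_of_dual ▸ List.mem_map_of_mem (hPsub e he))
    have hT2 : ((W.zip W.tail).map fun f ↦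
        if IsDualPair (farP S.a) (primalNbr S.a) f.1 f.2 then (1 : ℤ) else 0).sum = 0 :=
      sum_map_eq_zero_of_forall _ _ fun f hf ↦ if_neg (hWf₁ f hf)
    rw [hT1, hT2, if_pos (isDualPair_far S.a).symm_left.symm_right]
    norm_num
  rw [hone] at hpar
  norm_num at hpar

/-- **The rest of a Peano path starting with the dual step is a Peano path of the peeled data**
([LSW04] Lemma 4.1, forward direction). [cite: LawlerSchrammWerner2004, Lemma 4.1] -/
theorem IsPath.tail_peelE (h : S.Good) {l : List (ℤ × ℤ)} (hl : S.IsPath (S.a :: l))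
    (hne : l ≠ []) (hhead : l.head hne = stepD S.a) : S.peelE.IsPath l := by
  have hE : S.CanE := hl.canE_of_head h hne hhead
  have ha : S.a ∉ l := (List.nodup_cons.1 hl.nodup).1
  refine
    { ne_nil := hne
      head_eq := hhead
      getLast_eq := by
        have := hl.getLast_eq
        rw [List.getLast_cons hne] at this
        exact this
      isChain := hl.isChain.tail
      nodup := (List.nodup_cons.1 hl.nodup).2
      mem_iff := fun p ↦ ?_
      unblocked := ?_ }
  · simp only [peelE_a, peelE_b, peelE_V, Finset.mem_erase]
    have key := hl.mem_iff p
    rw [List.mem_cons] at key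
    constructor
    · intro hp
      have hpa : p ≠ S.a := fun e ↦ ha (e ▸ hp)
      rcases key.1 (Or.inr hp) with h1 | h1 | h1
      · exact absurd h1 hpa
      · exact Or.inr (Or.inl h1)
      · by_cases hps : p = stepD S.a
        · exact Or.inl hps
        · exact Or.inr (Or.inr ⟨hps, h1⟩)
    · rintro (h1 | h1 | ⟨-, h1⟩)
      · rw [h1, ← hhead]
        exact List.head_mem hne
      · subst h1
        exact (key.2 (Or.inr (Or.inl rfl))).resolve_left (Ne.symm h.a_ne_b)
      · exact (key.2 (Or.inr (Or.inr h1))).resolve_left fun e ↦ h.a_notMem (e ▸ h1)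
  · intro e he
    have he' : e ∈ (S.a :: l).zip (S.a :: l).tail := (mem_zip_cons_iff S.a l hne e).2 (Or.inr he)
    have hub := hl.unblocked e he'
    by_cases hf1 : s(primalNbr e.1, farP e.1) = s(primalNbr S.a, farP S.a)
    · have he1 : e.1 ∈ l := (List.of_mem_zip he).1
      have hpa : e.1 ≠ S.a := fun h1 ↦ ha (h1 ▸ he1)
      have hpc : e.1 = coSrc S.a := (eq_or_eq_coSrc_of_farP hf1).resolve_left hpa
      rintro (⟨hq, -⟩ | ⟨hq, hm⟩)
      · rw [hpc, stepP_coSrc] at hq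
        have he2 : e.2 ∈ l.tail := (List.of_mem_zip he).2
        rw [hq] at he2
        exact head_notMem_tail hne (List.nodup_cons.1 hl.nodup).2 (hhead ▸ he2)
      · rw [hpc, dualNbr_coSrc, farD_coSrc, Sym2.eq_swap] at hm
        exact hE.1 hm
    · rw [h.blocked_peelE_iff hE hf1]
      exact hub


/-! ### The exchange is an involution -/

/-- `swap ∘ swap = id` on peeling data. [folklore] -/
theorem swap_swap (S : PeelData) : S.swap.swap = S := by
  obtain ⟨V, α, β, a, b⟩ := S
  simp only [swap, swapIdx_swapIdx, map_swapIdx_map_swapIdx]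
  congr 1
  ext p
  simp only [Finset.mem_map, Function.Embedding.coeFn_mk]
  constructor
  · rintro ⟨q, ⟨r, hr, rfl⟩, rfl⟩
    simpa using hr
  · intro hp
    exact ⟨swapIdx p, ⟨p, hp, rfl⟩, swapIdx_swapIdx p⟩

/-- A Peano path read through the exchange is a Peano path of the exchanged data. [folklore] -/
theorem IsPath.swap {l : List (ℤ × ℤ)} (hl : S.IsPath l) : S.swap.IsPath (l.map swapIdx) := by
  have : S.swap.swap.IsPath l := by rw [swap_swap]; exact hl
  exact this.of_swap

/-! ### Classification of Peano paths by their first step -/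

/-- A Peano path is its initial vertex `a` followed by its tail. [folklore] -/
theorem IsPath.eq_cons {l : List (ℤ × ℤ)} (hl : S.IsPath l) : l = S.a :: l.tail := by
  obtain ⟨x, t, rfl⟩ := List.exists_cons_of_ne_nil hl.ne_nil
  have := hl.head_eq
  rw [List.head_cons] at this
  rw [this, List.tail_cons]

/-- A Peano path of good data has at least two vertices. [folklore] -/
theorem IsPath.tail_ne_nil (h : S.Good) {l : List (ℤ × ℤ)} (hl : S.IsPath l) : l.tail ≠ [] := by
  intro ht
  have e := hl.eq_cons
  rw [ht] at e
  have h1 := hl.getLast_eq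
  have h2 : l.getLast hl.ne_nil = S.a := by simp [e]
  exact h.a_ne_b (h2.symm.trans h1)

/-- The path, re-displayed as `a :: tail`. [folklore] -/
theorem IsPath.cons_tail {l : List (ℤ × ℤ)} (hl : S.IsPath l) : S.IsPath (S.a :: l.tail) := by
  rw [← hl.eq_cons]; exact hl

/-- The second vertex of a Peano path is `stepD a` or `stepP a`. [folklore] -/
theorem IsPath.head_tail (h : S.Good) {l : List (ℤ × ℤ)} (hl : S.IsPath l) :
    l.tail.head (hl.tail_ne_nil h) = stepD S.a ∨ l.tail.head (hl.tail_ne_nil h) = stepP S.a := by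
  have hc := hl.cons_tail.isChain
  obtain ⟨y, t, hyt⟩ := List.exists_cons_of_ne_nil (hl.tail_ne_nil h)
  simp only [hyt, List.head_cons]
  rw [hyt, List.isChain_cons_cons] at hc
  exact (manhattan_iff_step _ _).1 hc.1

/-- With an interior vertex, an available dual step does not end at `b`. [folklore] -/
theorem Good.stepD_ne_b (h : S.Good) (hV : S.V ≠ ∅) (hE : S.CanE) : stepD S.a ≠ S.b :=
  fun hb ↦ hV (h.eq_empty_of_stepD_eq hE hb)

/-- With an interior vertex, the exchanged data has an interior vertex. [folklore] -/
theorem swap_V_ne_empty (hV : S.V ≠ ∅) : S.swap.V ≠ ∅ := by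
  intro h0
  apply hV
  rw [← Finset.card_eq_zero, ← card_swap_V, h0, Finset.card_empty]

/-- **Classification of the Peano paths of good data by their first step** ([LSW04] Lemma 4.1 at
`n = 1`, both directions): the paths starting with the dual step correspond to the pairs
(the dual step is available, a Peano path of the peeled data `S.peelE`), and the paths starting
with the primal step, read through the exchange, to the same for the exchanged data `S.swap` —
when there is an interior vertex. [cite: LawlerSchrammWerner2004, Lemma 4.1] -/
noncomputable def pathSplit (h : S.Good) (hV : S.V ≠ ∅) :
    {l // S.IsPath l} ≃
      ({l // S.CanE ∧ S.peelE.IsPath l} ⊕ {l // S.swap.CanE ∧ S.swap.peelE.IsPath l}) where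
  toFun γ := by
    classical
    exact if hd : γ.1.tail.head (γ.2.tail_ne_nil h) = stepD S.a then
      Sum.inl ⟨γ.1.tail, γ.2.cons_tail.canE_of_head h (γ.2.tail_ne_nil h) hd,
        γ.2.cons_tail.tail_peelE h (γ.2.tail_ne_nil h) hd⟩
    else
      have hP : γ.1.tail.head (γ.2.tail_ne_nil h) = stepP S.a := (γ.2.head_tail h).resolve_left hd
      have hl' : S.swap.IsPath (S.swap.a :: γ.1.tail.map swapIdx) := by
        have := γ.2.cons_tail.swap
        simpa using this
      have hne' : γ.1.tail.map swapIdx ≠ [] := by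
        rw [ne_eq, List.map_eq_nil_iff]
        exact γ.2.tail_ne_nil h
      have hd' : (γ.1.tail.map swapIdx).head hne' = stepD S.swap.a := by
        rw [List.head_map, hP, swap_a, stepD_swapIdx]
      Sum.inr ⟨γ.1.tail.map swapIdx, hl'.canE_of_head h.swap hne' hd', hl'.tail_peelE h.swap hne' hd'⟩
  invFun := Sum.elim
    (fun x ↦ ⟨S.a :: x.1, IsPath.cons_peelE h x.2.1 (h.stepD_ne_b hV x.2.1) x.2.2⟩)
    (fun x ↦ ⟨(S.swap.a :: x.1).map swapIdx,
      (IsPath.cons_peelE h.swap x.2.1 (h.swap.stepD_ne_b (swap_V_ne_empty hV) x.2.1) x.2.2).of_swap⟩)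
  left_inv γ := by
    classical
    by_cases hd : γ.1.tail.head (γ.2.tail_ne_nil h) = stepD S.a
    · simp only [hd, dite_true, Sum.elim_inl]
      exact Subtype.ext γ.2.eq_cons.symm
    · simp only [hd, dite_false, Sum.elim_inr]
      refine Subtype.ext ?_
      simp only [List.map_cons, swap_a, swapIdx_swapIdx, map_swapIdx_map_swapIdx]
      exact γ.2.eq_cons.symm
  right_inv x := by
    classical
    rcases x with ⟨l, hE, hl⟩ | ⟨l, hE, hl⟩
    · have hd : (S.a :: l).tail.head (by simpa using hl.ne_nil) = stepD S.a := by
        simpa using hl.head_eq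
      simp only [Sum.elim_inl]
      rw [dif_pos hd]
      rfl
    · have hne : l ≠ [] := hl.ne_nil
      have hhead : l.head hne = stepD S.swap.a := hl.head_eq
      have hd : ¬ ((S.swap.a :: l).map swapIdx).tail.head (by simpa using hne) = stepD S.a := by
        simp only [List.map_cons, List.tail_cons, List.head_map, hhead, swap_a, stepD_swapIdx,
          swapIdx_swapIdx]
        exact (stepD_ne_stepP _).symm
      simp only [Sum.elim_inr]
      rw [dif_neg hd]
      congr 1
      refine Subtype.ext ?_
      simp [Function.comp_def]

/-! ### No interior vertex: the unique path `[a, b]` -/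

/-- **With no interior vertex the Peano path is `[a, b]`.** [folklore] -/
theorem IsPath.eq_pair_of_empty (h : S.Good) (hV : S.V = ∅) {l : List (ℤ × ℤ)} (hl : S.IsPath l) :
    l = [S.a, S.b] := by
  have e := hl.eq_cons
  obtain ⟨y, t, hyt⟩ := List.exists_cons_of_ne_nil (hl.tail_ne_nil h)
  rw [hyt] at e
  have hnd := hl.nodup
  rw [e] at hnd
  have hmem : ∀ p ∈ y :: t, p = S.b := by
    intro p hp
    have hp' : p ∈ l := by rw [e]; exact List.mem_cons_of_mem _ hp
    rcases (hl.mem_iff p).1 hp' with h1 | h1 | h1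
    · exact absurd (h1 ▸ hp) (List.nodup_cons.1 hnd).1
    · exact h1
    · simp [hV] at h1
  have hy : y = S.b := hmem y List.mem_cons_self
  have ht : t = [] := by
    rcases t with _ | ⟨z, t⟩
    · rfl
    · have hz : z = S.b := hmem z (by simp)
      have := (List.nodup_cons.1 (List.nodup_cons.1 hnd).2).1
      exact absurd (by rw [hy, hz]; exact List.mem_cons_self) this
  rw [e, hy, ht]

/-- With no interior vertex there is exactly one Peano path. [folklore] -/
theorem card_isPath_of_empty (h : S.Good) (hV : S.V = ∅) : Nat.card {l // S.IsPath l} = 1 := by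
  obtain ⟨l₀, hl₀⟩ := h.exists_isPath_of_empty hV
  rw [Nat.card_eq_one_iff_exists]
  exact ⟨⟨l₀, hl₀⟩, fun γ ↦ Subtype.ext ((γ.2.eq_pair_of_empty h hV).trans (hl₀.eq_pair_of_empty h hV).symm)⟩

/-! ### Finiteness and the counting recursion -/

/-- The Peano paths of peeling data form a finite type (repetition-free lists on `V ∪ {a, b}`).
[folklore] -/
instance instFinite_isPath (S : PeelData) : Finite {l // S.IsPath l} := by
  classical
  set F : Finset (ℤ × ℤ) := insert S.a (insert S.b S.V) with hF
  have ha : S.a ∈ F := by simp [hF]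
  let emb : {l // S.IsPath l} → {m : List F // m.length ≤ F.card} := fun γ ↦
    ⟨γ.1.map fun x ↦ if hx : x ∈ F then ⟨x, hx⟩ else ⟨S.a, ha⟩, by
      rw [List.length_map, ← List.toFinset_card_of_nodup γ.2.nodup]
      refine Finset.card_le_card fun x hx ↦ ?_
      rw [List.mem_toFinset] at hx
      rcases (γ.2.mem_iff x).1 hx with rfl | rfl | h1 <;> simp [*]⟩
  haveI : Finite {m : List F // m.length ≤ F.card} := (List.finite_length_le F F.card).to_subtype
  refine Finite.of_injective emb fun γ γ' hγ ↦ Subtype.ext ?_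
  have key : ∀ γ : {l // S.IsPath l},
      (γ.1.map fun x ↦ if hx : x ∈ F then (⟨x, hx⟩ : F) else ⟨S.a, ha⟩).map Subtype.val = γ.1 := by
    intro γ
    rw [List.map_map]
    conv_rhs => rw [← List.map_id γ.1]
    refine List.map_congr_left fun x hx ↦ ?_
    have hxF : x ∈ F := by
      rcases (γ.2.mem_iff x).1 hx with rfl | rfl | h1 <;> simp [*]
    simp [hxF]
  have := congrArg (fun m : {m : List F // m.length ≤ F.card} ↦ m.1.map Subtype.val) hγ
  simpa only [emb, key] using this

/-- Paths of `S'` satisfying an extra condition form a finite type. [folklore] -/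
instance instFinite_and_isPath (P : Prop) (S' : PeelData) : Finite {l // P ∧ S'.IsPath l} :=
  Finite.of_injective (fun x : {l // P ∧ S'.IsPath l} ↦ (⟨x.1, x.2.2⟩ : {l // S'.IsPath l}))
    fun _ _ hxy ↦ Subtype.ext (by simpa using congrArg Subtype.val hxy)

/-- Conditioning a subtype on a proposition. [folklore] -/
theorem natCard_and_left (P : Prop) [Decidable P] {X : Type*} (Q : X → Prop) [Finite {x // Q x}] :
    Nat.card {x // P ∧ Q x} = if P then Nat.card {x // Q x} else 0 := by
  split_ifs with hP
  · exact Nat.card_congr (Equiv.subtypeEquivRight fun x ↦ by simp [hP])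
  · rw [Nat.card_eq_zero]
    exact Or.inl ⟨fun x ↦ hP x.2.1⟩

/-- **The counting recursion for Peano paths** ([LSW04] Lemma 4.1): with an interior vertex,
the number of Peano paths of `S` is the number of Peano paths of the peeled data (if the dual
step is available) plus the number of Peano paths of the peeled exchanged data (if the primal
step is available). [cite: LawlerSchrammWerner2004, Lemma 4.1] -/
theorem card_isPath_eq (h : S.Good) (hV : S.V ≠ ∅) [Decidable S.CanE] [Decidable S.swap.CanE] :
    Nat.card {l // S.IsPath l} =
      (if S.CanE then Nat.card {l // S.peelE.IsPath l} else 0) +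
        (if S.swap.CanE then Nat.card {l // S.swap.peelE.IsPath l} else 0) := by
  rw [Nat.card_congr (pathSplit h hV), Nat.card_sum, natCard_and_left, natCard_and_left]

end PeelData


end USTPeano

end Literature.Probability.RandomPlanarGeometry
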